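import Mathlib
import HarnessLib
import Summits.NavierStokesRegularity.FluidComputer.TriggeredTransferH1
import Summits.NavierStokesRegularity.FluidComputer.TriggeredTransferEulerInstanceVariants

/-!
# Fluid computer, door N1-FC, DOOR v2 — non-vacuity of the type and of its one-step predicates
# (the Gavrilov alphabet through `TriggerScheme.toH1`)

Cell `ns-blowup`, seat `ns-blowup-fc-prover-2` (g5); BC2/BC5-style calibration for the NEW review-lane type
`TriggerSchemeH1` (`TriggeredTransferH1.lean`, fc-route g3 RULING, ns-blowup STATUS l.3869). LABEL: calibration.
WHAT THIS IS NOT: not Navier–Stokes evidence — the v1 instances of fc-prover-1 g3 (`SteadyBlob.scheme`, a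
PRESCRIBED compactly supported forced EULER flow, `ν = 0`, UNIT trigger: `step_one`, `stepB_one`) read through
the embedding `TriggerScheme.toH1`; nothing about `Transfers ν` (any `ν`), small triggers or blow-up is claimed,
and the instance says nothing v2-SPECIFIC (its members are rapidly decaying — it lies in the image of `toH1`).

Contents: `nonempty_triggerSchemeH1`; `SteadyBlob.stepH1_one`, `SteadyBlob.stepBH1_one`;
`exists_stepH1_inviscid_unit_trigger`, `exists_stepBH1_inviscid_unit_trigger`. The v2 type is inhabited and
its predicates `Step` / `StepB` are satisfiable (at `ν = 0`, `ε = 1`), exactly as v1's — so `TriggerSchemeH1`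
passes the same vacuity probes as `TriggerScheme`, no more: the door's content remains `Transfers ν`, `ν > 0`,
`ε ↓ 0`. References: A. V. Gavrilov, Geom. Funct. Anal. 29 (2019) 190–197, §1 Theorem (compactly supported steady
Euler flow; tree theorem `gavrilov_compact_steady_euler_holds`) [cite: Gavrilov2019, §1 Theorem]; T. Tao, J. Amer. Math. Soc. 29 (2016)
§1.3 [cite: Tao2016AveragedNS, §1.3].

0 sorry; axioms ⊆ {propext, Classical.choice, Quot.sound}.
-/

noncomputable section

namespace Summit.NavierStokesRegularity.FluidComputer.TriggeredTransfer

open Set MeasureTheory Function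
open scoped ENNReal ContDiff NNReal
open Literature.Analysis.FluidPDE
open Literature.Analysis.FluidPDE.FluidComputer (E3 Vel)

/-- **The v2 door's static type is inhabited**: the Gavrilov alphabet of a steady blob, read through
`TriggerScheme.toH1`. [cite: Gavrilov2019, §1 Theorem] -/
theorem nonempty_triggerSchemeH1 : Nonempty TriggerSchemeH1 :=
  ⟨(Classical.choice SteadyBlob.nonempty).scheme.toH1⟩

namespace SteadyBlob

variable (B : SteadyBlob)

/-- The prescribed inviscid unit-trigger step of the Gavrilov alphabet is a v2 step (`toH1_step_iff`).
[cite: Gavrilov2019, §1 Theorem] -/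
theorem stepH1_one : B.scheme.toH1.Step 0 1 1 (fun x => (1 : ℝ) • B.G x) :=
  B.scheme.toH1_step_iff.2 B.step_one

/-- The same step with its ceiling is a v2 bounded step (`toH1_stepB_iff`). [cite: Gavrilov2019, §1 Theorem] -/
theorem stepBH1_one : B.scheme.toH1.StepB 0 1 1 (fun x => (1 : ℝ) • B.G x) :=
  B.scheme.toH1_stepB_iff.2 B.stepB_one

end SteadyBlob

/-- **The v2 one-step predicate is inhabited at zero viscosity with a unit trigger**: some v2 scheme, some
level `U ≥ U⋆` and some member `w ∈ F U` admit `Step 0 U 1 w` (a PRESCRIBED forced Euler transplant — the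
same degeneracy reading as v1's `exists_step_inviscid_unit_trigger`: the force does the transfer).
[cite: Gavrilov2019, §1 Theorem] -/
theorem exists_stepH1_inviscid_unit_trigger :
    ∃ (𝒮 : TriggerSchemeH1) (U : ℝ) (w : Vel), 𝒮.UStar ≤ U ∧ w ∈ 𝒮.F U ∧ 𝒮.Step 0 U 1 w := by
  obtain ⟨B⟩ := SteadyBlob.nonempty
  exact ⟨B.scheme.toH1, 1, fun x => (1 : ℝ) • B.G x, le_rfl, rfl, B.stepH1_one⟩

/-- **The v2 BOUNDED one-step predicate is inhabited at zero viscosity with a unit trigger.**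
[cite: Gavrilov2019, §1 Theorem] -/
theorem exists_stepBH1_inviscid_unit_trigger :
    ∃ (𝒮 : TriggerSchemeH1) (U : ℝ) (w : Vel), 𝒮.UStar ≤ U ∧ w ∈ 𝒮.F U ∧ 𝒮.StepB 0 U 1 w := by
  obtain ⟨B⟩ := SteadyBlob.nonempty
  exact ⟨B.scheme.toH1, 1, fun x => (1 : ℝ) • B.G x, le_rfl, rfl, B.stepBH1_one⟩

end Summit.NavierStokesRegularity.FluidComputer.TriggeredTransfer

end
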